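/-
Copyright (c) 2026. All rights reserved.
Released under Apache 2.0 license as described in the file LICENSE.
-/
import Literature.AlgebraicGeometry.ComplexMultiplication.HyperellipticJacobianSimpleFactorProductsExceptionalClasses
import HarnessLib

/-!
# `E_i × Y_{4p}` for every prime `p ≡ 3 (mod 4)`, `p ≥ 7`: the CM elliptic curve `E_i = X_4` times the SIMPLE `(p−1)/2`-fold `Y_{4p}` (`X_{4p} ∼ Y_{4p}²`) carries a rational `((p+1)/4,(p+1)/4)`-class outside `𝓓 ⊗ ℂ` ON ITSELF — F39's class on `X_4 × X_{4p}` descends; keeping a member whole in the sub-pair formalism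

Family `hodge`, cell `pub-hodgecm2` (COR-CM), KEPT Literature lane `lit-deligne-3` (generation 55, file F44; sequel of F42
`HyperellipticJacobianSimpleFactorProductsExceptionalClasses` and of F39 `HyperellipticJacobianFourTimesPrimeLevelExceptionalClasses`).  THEOREMS
ONLY: no definition, no named fact, no `sorry`, no instance; D-0026 net debt `0`.  Nothing here asserts the algebraicity of any class; HC_CM is NOT proved.

THE POINT.  F39 located, for every prime `p ≡ 3 (mod 4)`, `p ≠ 3`, an exceptional Hodge class of codimension `(p+1)/4` on the PIECE `X_4 × X_{4p}` of
`J_{4p}` (dimension `p`), through the weight `W = {(i₀, σ₋)} ⊔ {(i₁, σ_u) : u ≡ 1 (mod 4), 2(u mod p) < p}`.  Here `X_4 = E_i` is the CM elliptic curve of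
`ℚ(i)` (simple, kept whole), while `X_{4p} ∼ Y_{4p}²` with `Y_{4p}` SIMPLE of dimension `φ(4p)/4 = (p−1)/2` — ODD — and CM by
`L = ℚ(ζ_{4p} − ζ_{4p}^{−1})` (GGL Thm. 3.0 (5); `4p ∉ {20, 24, 60}` for `p ≥ 7` prime).  F42's descent applies: keep the member `X_4` whole (§1: the
trivial sub-pair `(⊤; Φ^⊤)`, transport of the realisation along `K ≅ ⊤`), replace `X_{4p}` by `Y_{4p}`, and check that restriction is injective on `W`
(§2): on `⊤` trivially; on `L` two exponents `u, u'` of `W` with `σ_u|_L = σ_{u'}|_L`, `u ≠ u'` would have `u + u' ≡ 2p (mod 4p)` (F42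
`expOf_eq_or_add_mod_eq_of_apply_eq`), so `p ∣ u + u'` — impossible since `0 < (u mod p) + (u' mod p) < p`.  Hence (§3) **`E_i × Y_{4p}` (dimension
`(p+1)/2`) carries a rational `((p+1)/4, (p+1)/4)`-class outside `𝓓 ⊗ ℂ`** — MIDDLE codimension — and is neither divisor-generated nor stably
nondegenerate, although `E_i`, `Y_{4p}` are simple, stably nondegenerate (F41) and `Hom = 0` both ways.

THE PRINT.  Moonen–Zarhin, Math. Ann. **315** (1999), Introduction (a) and Thm. 0.1 (1) [corpus: paper:arxiv-math_9901113 p. 1]: «(a) The abelian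
variety `X` is isogenous to a product `X₁ × X₂` where `X₁` is an elliptic curve with complex multiplication by an imaginary quadratic field `k` and where
`X₂` is a simple abelian threefold such that there exists an embedding `k ↪ End⁰(X₂)`. […] (1) Suppose we are in case (a) or (b). Then the Hodge ring
`B•(X)` is generated by the subalgebra `D•(X)` of divisor classes together with the space of Weil classes `W_k ⊂ B²(X)` […] in these cases we have
`D²(X) ≠ B²(X)`» — our `p = 7`: `E_i × Y_{28}`, `Y_{28}` a simple CM threefold with `i = ζ_{28}^7 ∈ ℚ(ζ_{28} − ζ_{28}^{−1})`.  The tree's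
`HodgeTheory/CMCurveTimesSimpleCMVarietyDichotomy` (Moonen–Zarhin Prop. (3.8); §4–§5 there) proves for `X` simple CM of ODD dimension with
`k ↪ End⁰(X)` that `E_k × X` is NOT stably nondegenerate, the exceptional class living on «some product of copies»; THIS file LOCATES it for the
`J_{4p}`-family: on `E × Y` itself, middle codimension.  Gallese–Goodson–Lombardo (2024) §3 Thm. 3.0 (5), §3.2 Lemma 11–12, §3.3; Goodson (2024) §3.1,
Lemma 4.2; Shimura (1998) §6.2 Thm. 3, §8.2 Prop. 26; Gordon (1999) 7.5–7.6.2, 9.2.2, §9.3; Milne (2020) 1.2 (c); Gao–Ullmo (2025) Thm. 3.1.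

WHAT IS PROVED.
* §1 **`exists_top_subPair`** — a realisation `A ⊨ (K; Φ)` realises the trivial sub-pair `(⊤; Φ^⊤)` with `(Φ^⊤)^K = Φ` (a member may be KEPT
  WHOLE in F42's sub-pair transport; the tree's `IsCMTypeRealisation.transport`, `PicardCM.CMCode.cmTypeMap`).
* §2 `add_mod_ne_of_weight` (`u + u' ≢ 2p (mod 4p)` on F39's exponents), **`injOn_restrict_weight_four_fourMulPrime`** (restriction to
  `(⊤, ℚ(ζ_{4p} − ζ_{4p}^{−1}))` is injective on F39's weight).
* §3 **`exists_simpleFactors_exceptional_of_lev_eq_four_fourMulPrime`** (`p ≡ 3 (mod 4)`, `p ≥ 7`) — for realisations `A_0 ⊨ (ℚ(i); Φ_4)`,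
  `A_1 ⊨ (ℚ(ζ_{4p}); Φ_{4p})`: `B_0 = A_0 = E_i` (dim `1`), `B_1 = Y_{4p}` simple with `2 dim = p − 1`, `A_1 ∼ B_1²`, both stably nondegenerate, orthogonal;
  an exceptional weight of `(⊤; Φ_4^⊤) ⊔ (L_1; Ψ_1)` in degree `(p+1)/4`; a rational `((p+1)/4,(p+1)/4)`-class outside `𝓓 ⊗ ℂ` on `B_0 ⊕ B_1` and on
  `B_0 × B_1` (`2 dim = p + 1`); neither divisor-generated nor stably nondegenerate.
* §4 hypothesis-free **`exists_cmCurve_simple_odd_exceptional_prod`**: for every prime `p ≡ 3 (mod 4)`, `p ≥ 7`, ∃ simple `E` (dim `1`) and simple `Y`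
  (`2 dim Y = p − 1`), stably nondegenerate, orthogonal, with `E × Y` carrying a rational `((p+1)/4,(p+1)/4)`-class outside `𝓓 ⊗ ℂ`, not
  divisor-generated, not stably nondegenerate — an INFINITE FAMILY (`p = 7`: a fourfold with `B² ≠ D²`; `p = 11`: a sixfold with `B³ ≠ D³`; …).
* §5 `zetaOf_pow_mem_and_sq_eq_neg_one_of_eq_adjoin` — `ζ_{4p}^p ∈ ℚ(ζ_{4p} − ζ_{4p}^{−1})` with square `−1` (`p` odd): `ℚ(i)` embeds into the CM field
  of `Y_{4p}` (Moonen–Zarhin's «`k ↪ End⁰(X₂)`» of case (a), on the CM-field level).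

HONEST.  Assembled from tree theorems (F39's weight with its balance ∕ non-divisoriality proofs, F41's stable nondegeneracy of `X_4` and `X_{4p}`,
F42's transport and simple-factor data, the tree's realisation transport) plus §2's elementary arithmetic.  §5 types `i = ζ^p ∈ L` (so `ℚ(i) ⊂ L`, and `𝓞_L` acts on `Y_{4p}` through `ιB`); NOT typed: `End⁰(Y_{4p}) = L`, the
identification of the class with Moonen–Zarhin's Weil classes `W_k`, `B•(E × Y) = ⟨D•, W_k⟩`.  The case `p ≡ 1 (mod 4)` (F39: the class lives on
`X_{4p}` alone, where `Y_{4p}` is itself degenerate) is not treated here.  No numerics; no algebraicity claim.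

## References
* [MoonenZarhin1999LowDim] B. Moonen, Yu. Zarhin, Math. Ann. 315 (1999) 711–733: Introduction (a), Thm. 0.1 (1), §3 (3.1), Prop. (3.8)
  [corpus: paper:arxiv-math_9901113 pp. 1, 6–7]. [cite: MoonenZarhin1999LowDim, Introduction (a), Thm. 0.1 (1) and Prop. (3.8)]
* [GalleseGoodsonLombardo2024] Gallese–Goodson–Lombardo, §3 Thm. 3.0 (5), §3.2 Lemma 11–12, §3.3. [cite: GalleseGoodsonLombardo2024, §3 Thm. 3.0 (5) and §3.2 Lemma 12]
* [Goodson2024DegeneracyFermat] H. Goodson, §3.1 and Lemma 4.2. [cite: Goodson2024DegeneracyFermat, Lemma 4.2 and §3.1]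
* [Gordon1999HodgeAVSurvey] B. B. Gordon, Thm. 7.5, Def. 7.6, 7.6.1, Thm. 7.6.2, 9.2.2, §9.3. [cite: Gordon1999HodgeAVSurvey, 9.2.2 and Thm. 7.6.2]
* [Shimura1998] G. Shimura (1998), §6.2 Thm. 3, §8.2 Prop. 26. [cite: Shimura1998, §6.2 Thm. 3 and §8.2 Prop. 26]
* [Milne2020HodgeClassesAV] J. S. Milne (2020), 1.2 (c). [cite: Milne2020HodgeClassesAV, 1.2 (c)]
* [GaoUllmo2025] Z. Gao, E. Ullmo, Thm. 3.1. [cite: GaoUllmo2025, Thm. 3.1]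
* [MumfordAV1970] D. Mumford, *Abelian Varieties*, §19 Thm. 1. [cite: MumfordAV1970, §19 Thm. 1]
-/

open CategoryTheory CategoryTheory.Limits NumberField Module

namespace Literature.AlgebraicGeometry.ComplexMultiplication

open Literature.AlgebraicGeometry.Motives
open Literature.AlgebraicGeometry.Motives.AbelianVariety
open Literature.AlgebraicGeometry.HodgeTheory (complexBetti IsRationalClass IsOfHodgeType IsStablyNondegenerate
  IsDivisorGenerated HodgeConjectureFor)
open Literature.AlgebraicGeometry.VanGeemen1994 (hodgeClassSpan)
open Literature.Barriers.HodgeConjecture (divisorClassesSpan)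
open Literature.NumberTheory.ComplexMultiplication
open Literature.NumberTheory.Automorphic (PicardCM.CMCode.cmTypeMap PicardCM.CMCode.mem_cmTypeMap_iff)

namespace HyperellipticJacobian

open Literature.AlgebraicGeometry.Pohlmann1968 Literature.AlgebraicGeometry.Pohlmann1968.Cyclotomic
open Literature.AlgebraicGeometry.Pohlmann1968.CMAlgebra

/-! ## §1 Keeping a member whole: the top sub-pair `(K^⊤ = K; Φ)` -/

section Top

variable {K : Type} [Field K] [NumberField K]

/-- **The trivial sub-pair.**  A realisation `A ⊨ (K; Φ)` is a realisation of the sub-pair `(⊤; Φ^⊤)` of index `1` (`⊤ ⊆ K` the top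
intermediate field, `Φ^⊤` the type transported along `K ≅ ⊤`), and `(Φ^⊤)^K = Φ` — so a member of a CM algebra may be KEPT WHOLE in the
sub-pair formalism of F42 §1 (transport of structure, the tree's `IsCMTypeRealisation.transport`). [cite: Shimura1998, §6.2 Thm. 3 (h = 1)] -/
theorem exists_top_subPair (Φ : CMType K) {A : AbelianVariety ℂ} {ι : 𝓞 K →+* End A}
    {θ : K →+* Module.End ℂ (complexBetti A.X 1)} (hA : IsCMTypeRealisation Φ A ι θ) :
    ∃ (L : IntermediateField ℚ K) (Ψ : CMType L) (ιB : 𝓞 L →+* End A) (θB : L →+* Module.End ℂ (complexBetti A.X 1)),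
      L = ⊤ ∧ inducedCMType (algebraMap L K) Ψ = Φ ∧ IsCMTypeRealisation Ψ A ιB θB := by
  let e : K ≃+* (⊤ : IntermediateField ℚ K) := (IntermediateField.topEquiv (F := ℚ) (E := K)).symm.toRingEquiv
  refine ⟨⊤, PicardCM.CMCode.cmTypeMap e Φ, _, _, rfl, ?_, hA.transport e⟩
  apply Subtype.ext
  ext τ
  rw [mem_inducedCMType_iff, PicardCM.CMCode.mem_cmTypeMap_iff]
  have hcomp : (τ.comp (algebraMap (⊤ : IntermediateField ℚ K) K)).comp e.toRingHom = τ := by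
    ext x
    change τ (((IntermediateField.topEquiv (F := ℚ) (E := K)).symm x : K)) = τ x
    simp
  rw [hcomp]

end Top

/-! ## §2 Restriction is injective on the weight of `X_4 × X_{4p}` (`p ≡ 3 (mod 4)`) for the sub-pairs `(⊤, ℚ(ζ_{4p} − ζ_{4p}^{−1}))` -/

section InjOn

variable {k : ℕ} {lev : Fin k → ℕ} [∀ i, NeZero (lev i)] {K : Fin k → Type} [∀ i, Field (K i)]
  [∀ i, NumberField (K i)] [∀ i, IsCyclotomicExtension {lev i} ℚ (K i)] {L : ∀ i, IntermediateField ℚ (K i)} {p : ℕ}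

/-- **No two exponents `u, u'` of F39's weight (`u ≡ u' ≡ 1 (mod 4)`, `2(u mod p) < p`, `2(u' mod p) < p`, units of `ℤ/4p`) have
`u + u' ≡ 2p (mod 4p)`**: otherwise `p ∣ u + u'`, but `0 < (u mod p) + (u' mod p) < p`. [cite: GalleseGoodsonLombardo2024, §3.2 Lemma 12]
[cite: Goodson2024DegeneracyFermat, §3.1] -/
theorem add_mod_ne_of_weight (hp : p.Prime) {a b : ℕ} (ha : a.Coprime (4 * p)) (h2a : 2 * (a % p) < p) (h2b : 2 * (b % p) < p) :
    (a + b) % (4 * p) ≠ 4 * p / 2 := by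
  intro h
  have hp0 : 0 < p := hp.pos
  have hdiv := Nat.div_add_mod (a + b) (4 * p)
  rw [h, show 4 * p / 2 = 2 * p by omega] at hdiv
  have hdvd : p ∣ a + b := ⟨4 * ((a + b) / (4 * p)) + 2, by linarith⟩
  have hmod : (a % p + b % p) % p = 0 := by
    rw [← Nat.add_mod]
    exact Nat.mod_eq_zero_of_dvd hdvd
  have hlt : a % p + b % p < p := by omega
  rw [Nat.mod_eq_of_lt hlt] at hmod
  have ha0 : a % p = 0 := by omega
  have hpa : p ∣ a := Nat.dvd_of_mod_eq_zero ha0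
  have hcop : a.Coprime p := ha.coprime_dvd_right ⟨4, by ring⟩
  exact hp.one_lt.ne' (Nat.Coprime.eq_one_of_dvd hcop.symm hpa)

/-- **RESTRICTION TO `(⊤, ℚ(ζ_{4p} − ζ_{4p}^{−1}))` IS INJECTIVE ON F39'S WEIGHT `W = {(i₀, σ₋)} ⊔ {(i₁, σ_u) : u ≡ 1 (4), 2(u mod p) < p}`**:
on the member `i₀` (kept whole, `L_{i₀} = ⊤`) restriction is injective outright; on the member `i₁` two points agreeing on `ζ − ζ^{−1}` have
`u = u'` or `u + u' ≡ 2p (mod 4p)` (F42 `expOf_eq_or_add_mod_eq_of_apply_eq`), and the latter is excluded by `add_mod_ne_of_weight`.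
[cite: GalleseGoodsonLombardo2024, §3.3] [cite: Shimura1998, §8.2 Prop. 26] -/
theorem injOn_restrict_weight_four_fourMulPrime (hp : p.Prime) {i₀ i₁ : Fin k} (hne : i₀ ≠ i₁) (h₁ : lev i₁ = 4 * p)
    (hL₀ : L i₀ = ⊤) (hζ₁ : zetaOf (lev i₁) (K i₁) - (zetaOf (lev i₁) (K i₁))⁻¹ ∈ L i₁) :
    Set.InjOn (fun x : (i : Fin k) × (K i →+* ℂ) =>
        (⟨x.1, x.2.comp (algebraMap (L x.1) (K x.1))⟩ : (i : Fin k) × (L i →+* ℂ)))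
      ↑(Finset.univ.filter fun x : (i : Fin k) × (K i →+* ℂ) =>
        (x.1 = i₀ ∧ ((4 * p / lev x.1 * (expOf (lev x.1) (K x.1) x.2).val : ℕ) : ZMod (4 * p)) = ((3 * p : ℕ) : ZMod (4 * p))) ∨
        (x.1 = i₁ ∧ (((4 * p / lev x.1 * (expOf (lev x.1) (K x.1) x.2).val : ℕ) : ZMod (4 * p))).val % 4 = 1 ∧
          2 * ((((4 * p / lev x.1 * (expOf (lev x.1) (K x.1) x.2).val : ℕ) : ZMod (4 * p))).val % p) < p)) := by
  classical
  rintro ⟨i, σ⟩ hx ⟨i', σ'⟩ hx' hres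
  rw [Finset.coe_filter, Set.mem_setOf_eq] at hx hx'
  simp only [Sigma.mk.inj_iff] at hres
  obtain ⟨hii, hheq⟩ := hres
  subst hii
  have hcomp := eq_of_heq hheq
  rcases hx.2 with ⟨hi, -⟩ | ⟨hi, hmod, hlt⟩
  · -- the member kept whole: restriction to `⊤` is injective
    subst hi
    have h : σ = σ' := by
      ext x
      have hxtop : x ∈ L i := by rw [hL₀]; exact IntermediateField.mem_top
      exact RingHom.congr_fun hcomp ⟨x, hxtop⟩
    rw [h]
  · subst hi
    rcases hx'.2 with ⟨hi', -⟩ | ⟨-, hmod', hlt'⟩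
    · exact absurd hi' (Ne.symm hne)
    · have hpne : NeZero (4 * p) := ⟨by have := hp.pos; omega⟩
      have happ : σ (zetaOf (lev i) (K i) - (zetaOf (lev i) (K i))⁻¹) = σ' (zetaOf (lev i) (K i) - (zetaOf (lev i) (K i))⁻¹) := by
        have := RingHom.congr_fun hcomp ⟨_, hζ₁⟩
        simpa using this
      have h2 : 2 ∣ lev i := ⟨2 * p, by rw [h₁]; ring⟩
      rcases expOf_eq_or_add_mod_eq_of_apply_eq h2 happ with he | hsum
      · rw [expOf_injective (lev i) (K i) he]
      · exfalso
        -- read the lifted residues as the exponents themselves (`4p / 4p = 1`)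
        have hdiv1 : 4 * p / lev i = 1 := by rw [h₁]; exact Nat.div_self (by have := hp.pos; omega)
        have hval : ∀ τ : K i →+* ℂ, (expOf (lev i) (K i) τ).val < 4 * p := fun τ => lt_of_lt_of_eq (ZMod.val_lt _) h₁
        have hlift : ∀ τ : K i →+* ℂ, (((4 * p / lev i * (expOf (lev i) (K i) τ).val : ℕ) : ZMod (4 * p))).val =
            (expOf (lev i) (K i) τ).val := fun τ => by
          rw [ZMod.val_natCast, hdiv1, one_mul, Nat.mod_eq_of_lt (hval τ)]
        rw [hlift] at hlt hlt'
        have hcop := coprime_expOf (lev i) (K i) σ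
        generalize (expOf (lev i) (K i) σ).val = a at hsum hlt hcop
        generalize (expOf (lev i) (K i) σ').val = b at hsum hlt'
        rw [h₁] at hsum hcop
        exact add_mod_ne_of_weight hp hcop hlt hlt' hsum

end InjOn

/-! ## §3 `E_i × Y_{4p}` (`p ≡ 3 (mod 4)`, `p ≥ 7` prime): a rational `((p+1)/4, (p+1)/4)`-class outside `𝓓 ⊗ ℂ` on the product of the
## CM elliptic curve `E_i = X_4` and the SIMPLE `(p−1)/2`-fold `Y_{4p}` -/

section FourFourMulPrime

variable {lev : Fin 2 → ℕ} [∀ i, NeZero (lev i)] {K : Fin 2 → Type} [∀ i, Field (K i)] [∀ i, NumberField (K i)]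
  [∀ i, IsCyclotomicExtension {lev i} ℚ (K i)] {Φ : ∀ i, CMType (K i)} {A : Fin 2 → AbelianVariety ℂ}
  {ι : ∀ i, 𝓞 (K i) →+* End (A i)} {θ : ∀ i, K i →+* Module.End ℂ (complexBetti (A i).X 1)} {p : ℕ}

/-- Stable nondegeneracy passes from `P 0 × P 1` to `⨁_{i : Fin 2} P i`, and exceptional classes ∕ failure of `B = D` pass from the biproduct to
the product (the retraction `(π₀, π₁) ≫ (fst ≫ ι₀ + snd ≫ ι₁) = 𝟙`; private copy of F42's helper). [cite: Gordon1999HodgeAVSurvey, 7.6.1] -/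
private theorem prod_of_biproduct_two' (P : Fin 2 → AbelianVariety ℂ) :
    (IsStablyNondegenerate ((P 0).prod (P 1)) → IsStablyNondegenerate (⨁ P)) ∧
    (IsDivisorGenerated ((P 0).prod (P 1)) → IsDivisorGenerated (⨁ P)) ∧
    ∀ {q : ℕ}, (∃ c : complexBetti (⨁ P).X (2 * q), IsRationalClass c ∧ IsOfHodgeType (⨁ P).dim (⨁ P).X (2 * q) q q c ∧
        c ∉ divisorClassesSpan (⨁ P).X (⨁ P).dim q) →
      ∃ c : complexBetti ((P 0).prod (P 1)).X (2 * q), IsRationalClass c ∧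
        IsOfHodgeType ((P 0).prod (P 1)).dim ((P 0).prod (P 1)).X (2 * q) q q c ∧
        c ∉ divisorClassesSpan ((P 0).prod (P 1)).X ((P 0).prod (P 1)).dim q := by
  let t : (⨁ P) ⟶ (P 0).prod (P 1) := AbelianVariety.prodLift (biproduct.π P 0) (biproduct.π P 1)
  let r : (P 0).prod (P 1) ⟶ ⨁ P :=
    AbelianVariety.fst (P 0) (P 1) ≫ biproduct.ι P 0 + AbelianVariety.snd (P 0) (P 1) ≫ biproduct.ι P 1
  have htr : t ≫ r = (1 : ℕ) • 𝟙 (⨁ P) := by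
    rw [one_smul]
    simp only [t, r, Preadditive.comp_add, ← Category.assoc, AbelianVariety.prodLift_fst, AbelianVariety.prodLift_snd]
    have htot := biproduct.total (f := P)
    rw [Fin.sum_univ_two] at htot
    exact htot
  exact ⟨HodgeTheory.IsStablyNondegenerate.of_comp_eq_nsmul_id t r one_ne_zero htr,
    HodgeTheory.IsDivisorGenerated.of_comp_eq_nsmul_id t r one_ne_zero htr,
    fun hc => exists_exceptional_of_comp_eq_nsmul_id t r one_ne_zero htr hc⟩

/-- **`E_i × Y_{4p}` CARRIES A RATIONAL `((p+1)/4, (p+1)/4)`-CLASS OUTSIDE `𝓓 ⊗ ℂ` ON ITSELF** (`p ≡ 3 (mod 4)`, `p ≥ 7` prime).  For realisations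
`A_0 ⊨ (ℚ(i); Φ_4)` (the CM elliptic curve `E_i = X_4`, kept whole: sub-pair `(⊤; Φ_4^⊤)`) and `A_1 ⊨ (ℚ(ζ_{4p}); Φ_{4p})` (`X_{4p} ∼ Y_{4p}²`,
`Y_{4p} = B_1` SIMPLE of ODD dimension `(p−1)/2`, with CM by `ℚ(ζ_{4p} − ζ_{4p}^{−1}) ∋ i = ζ_{4p}^p`): F39's exceptional weight
`{σ₋} ⊔ {σ_u : u ≡ 1 (4), 2(u mod p) < p}` of `X_4 × X_{4p}` has pairwise different restrictions (§2), so DESCENDS (F42 §1) to an exceptional weight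
of `(⊤; Φ_4^⊤) ⊔ (L_1; Ψ_1)` in degree `(p+1)/4`: **`E_i ⊕ Y_{4p}` and `E_i × Y_{4p}` (dimension `(p+1)/2`) carry a rational `((p+1)/4,(p+1)/4)`-class
outside `𝓓 ⊗ ℂ`**, are not divisor-generated, not stably nondegenerate — although `E_i` and `Y_{4p}` are stably nondegenerate (F41; `Y_{4p}` as a
quasi-retract of `X_{4p}`), simple, `Hom = 0` both ways.  For `p = 7` this is Moonen–Zarhin's fourfold case (a) — `E × T`, `T` a simple CM
threefold with `k = End⁰(E) ↪ End⁰(T)`, «`D²(X) ≠ B²(X)`» — explicit inside `J_{28}`; for every such `p` it LOCATES, on `E × Y` itself and in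
middle codimension, the exceptional classes whose existence on SOME product of copies the tree's `CMCurveTimesSimpleCMVarietyDichotomy` (§4, odd
dimension, `k ↪ End⁰`) asserts. [cite: MoonenZarhin1999LowDim, Introduction (a) and Thm. 0.1 (1)] [cite: GalleseGoodsonLombardo2024, §3 Thm. 3.0 (5) and §3.2 Lemma 12]
[cite: Goodson2024DegeneracyFermat, §3.1 and Lemma 4.2] [cite: Gordon1999HodgeAVSurvey, 9.2.2, §9.3 and Thm. 7.6.2] [cite: Shimura1998, §6.2 Thm. 3 and §8.2 Prop. 26]
[cite: GaoUllmo2025, Thm. 3.1] -/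
theorem exists_simpleFactors_exceptional_of_lev_eq_four_fourMulPrime (hp : p.Prime) (hp3 : p % 4 = 3) (hp7 : 7 ≤ p)
    (h0 : lev 0 = 4) (h1 : lev 1 = 4 * p)
    (hΦ : ∀ i (σ : K i →+* ℂ), σ ∈ (Φ i).1 ↔ 2 * (expOf (lev i) (K i) σ).val < lev i)
    (hA : ∀ i, IsCMTypeRealisation (Φ i) (A i) (ι i) (θ i)) :
    ∃ (L : ∀ i, IntermediateField ℚ (K i)) (Ψ : ∀ i, CMType (L i)) (B : Fin 2 → AbelianVariety ℂ)
      (ιB : ∀ i, 𝓞 (L i) →+* End (B i)) (θB : ∀ i, L i →+* Module.End ℂ (complexBetti (B i).X 1)),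
      (∀ i, inducedCMType (algebraMap (L i) (K i)) (Ψ i) = Φ i) ∧ (∀ i, IsCMTypeRealisation (Ψ i) (B i) (ιB i) (θB i)) ∧
      L 0 = ⊤ ∧ B 0 = A 0 ∧ L 1 = IntermediateField.adjoin ℚ {zetaOf (lev 1) (K 1) - (zetaOf (lev 1) (K 1))⁻¹} ∧
      Module.finrank (L 1) (K 1) = 2 ∧ IsIsogenous (A 1) (⨁ fun _ : Fin 2 => B 1) ∧
      (∀ i, (B i).IsSimple) ∧ (B 0).dim = 1 ∧ 2 * (B 1).dim = p - 1 ∧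
      IsStablyNondegenerate (B 0) ∧ IsStablyNondegenerate (B 1) ∧ (∀ u : B 0 ⟶ B 1, u = 0) ∧ (∀ v : B 1 ⟶ B 0, v = 0) ∧
      (pohlmannSetsAlg Ψ ((p + 1) / 4) \ pohlmannDivisorSetsAlg Ψ ((p + 1) / 4)).Nonempty ∧
      (∃ c : complexBetti (⨁ B).X (2 * ((p + 1) / 4)), IsRationalClass c ∧
        IsOfHodgeType (⨁ B).dim (⨁ B).X (2 * ((p + 1) / 4)) ((p + 1) / 4) ((p + 1) / 4) c ∧
        c ∉ divisorClassesSpan (⨁ B).X (⨁ B).dim ((p + 1) / 4)) ∧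
      ¬IsDivisorGenerated (⨁ B) ∧ ¬IsStablyNondegenerate (⨁ B) ∧ 2 * ((B 0).prod (B 1)).dim = p + 1 ∧
      (∃ c : complexBetti ((B 0).prod (B 1)).X (2 * ((p + 1) / 4)), IsRationalClass c ∧
        IsOfHodgeType ((B 0).prod (B 1)).dim ((B 0).prod (B 1)).X (2 * ((p + 1) / 4)) ((p + 1) / 4) ((p + 1) / 4) c ∧
        c ∉ divisorClassesSpan ((B 0).prod (B 1)).X ((B 0).prod (B 1)).dim ((p + 1) / 4)) ∧
      ¬IsDivisorGenerated ((B 0).prod (B 1)) ∧ ¬IsStablyNondegenerate ((B 0).prod (B 1)) := by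
  classical
  have hp2 : p ≠ 2 := by omega
  have hp3' : p ≠ 3 := by omega
  haveI : NeZero p := ⟨hp.ne_zero⟩
  haveI : NeZero (4 * p) := ⟨by have := hp.pos; omega⟩
  -- the sub-pair data, uniformly in the member: member `0` kept whole, member `1` replaced by its simple factor
  have key : ∀ i : Fin 2, ∃ (L : IntermediateField ℚ (K i)) (Ψ : CMType L) (B : AbelianVariety ℂ) (ιB : 𝓞 L →+* End B)
      (θB : L →+* Module.End ℂ (complexBetti B.X 1)),
      inducedCMType (algebraMap L (K i)) Ψ = Φ i ∧ IsCMTypeRealisation Ψ B ιB θB ∧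
      (lev i = 4 → L = ⊤ ∧ B = A i) ∧
      (lev i ≠ 4 → L = IntermediateField.adjoin ℚ {zetaOf (lev i) (K i) - (zetaOf (lev i) (K i))⁻¹} ∧ Module.finrank L (K i) = 2 ∧
        B.IsSimple ∧ 4 * B.dim = Nat.totient (lev i) ∧ IsIsogenous (A i) (⨁ fun _ : Fin 2 => B) ∧
        ∃ (t : B ⟶ A i) (h : A i ⟶ B) (N : ℕ), N ≠ 0 ∧ t ≫ h = N • 𝟙 B) := by
    refine Fin.forall_fin_two.2 ⟨?_, ?_⟩
    · obtain ⟨L, Ψ, ιB, θB, hL, hind, hB⟩ := exists_top_subPair (Φ 0) (hA 0)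
      exact ⟨L, Ψ, A 0, ιB, θB, hind, hB, fun _ => ⟨hL, rfl⟩, fun h => absurd h0 h⟩
    · have h4 : 4 ∣ lev 1 := ⟨p, h1⟩
      have h8 : 8 ≤ lev 1 := by rw [h1]; omega
      have h20 : lev 1 ≠ 20 := by rw [h1]; omega
      have h24 : lev 1 ≠ 24 := by rw [h1]; omega
      have h60 : lev 1 ≠ 60 := by
        rw [h1]; intro h
        have : p = 15 := by omega
        subst this; exact absurd hp (by decide)
      obtain ⟨L, Ψ, B, ιB, θB, t, h, N, hind, hfin, hL, -, hB, hs, hdim, hiso, hN, hth⟩ :=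
        exists_simpleFactor_retract h4 h8 h20 h24 h60 (hΦ 1) (hA 1)
      exact ⟨L, Ψ, B, ιB, θB, hind, hB, fun h => absurd h (by rw [h1]; omega), fun _ => ⟨hL, hfin, hs, hdim, hiso, t, h, N, hN, hth⟩⟩
  choose L Ψ B ιB θB hind hB hkeep hfac using key
  obtain ⟨hL0, hB0eq⟩ := hkeep 0 h0
  obtain ⟨hL1, hfin1, hs1, hdim1, hiso1, t, h, N, hN, hth⟩ := hfac 1 (by rw [h1]; omega)
  -- dimensions
  have hdA0 : 2 * (A 0).dim = Nat.totient (lev 0) := IsCMTypeRealisation.two_mul_dim_eq_totient (m := lev 0) (by rw [h0]; norm_num) (hA 0)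
  rw [h0, show Nat.totient 4 = 2 by decide] at hdA0
  have hd0 : (B 0).dim = 1 := by rw [hB0eq]; omega
  have htot : Nat.totient (4 * p) = 2 * (p - 1) := by
    rw [show 4 = 2 ^ 2 by norm_num, Nat.totient_mul ((Nat.coprime_pow_left_iff (by norm_num) 2 p).2
      ((Nat.coprime_primes (by decide) hp).2 hp2.symm)), Nat.totient_prime_pow (by decide) (by norm_num), Nat.totient_prime hp]
    norm_num
  have hd1 : 2 * (B 1).dim = p - 1 := by rw [h1, htot] at hdim1; omega
  -- simplicity, stable nondegeneracy, orthogonality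
  have hs0 : (B 0).IsSimple := isSimple_of_dim_le_one (by omega)
  have hs : ∀ i, (B i).IsSimple := Fin.forall_fin_two.2 ⟨hs0, hs1⟩
  have hB0st : IsStablyNondegenerate (B 0) := by
    rw [hB0eq]; exact isStablyNondegenerate_of_level_four h0 (hΦ 0) (hA 0)
  have hA1st : IsStablyNondegenerate (A 1) := isStablyNondegenerate_of_level_fourMulPrime_three_mod_four hp hp3 hp7 h1 (hΦ 1) (hA 1)
  have hB1st : IsStablyNondegenerate (B 1) := HodgeTheory.IsStablyNondegenerate.of_comp_eq_nsmul_id t h hN hth hA1st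
  have hne01 : (B 0).dim ≠ (B 1).dim := by omega
  have hu : ∀ u : B 0 ⟶ B 1, u = 0 := HodgeTheory.hom_eq_zero_of_isSimple_of_dim_ne (hs 0) (hs 1) hne01
  have hv : ∀ v : B 1 ⟶ B 0, v = 0 := HodgeTheory.hom_eq_zero_of_isSimple_of_dim_ne (hs 1) (hs 0) hne01.symm
  -- F39's weight descends
  have hdvd : ∀ i, lev i ∣ 4 * p := Fin.forall_fin_two.2 ⟨⟨p, h0 ▸ rfl⟩, by rw [h1]⟩
  have hW := weight_four_fourMulPrime_mem_pohlmannSetsAlg_diff (lev := lev) (K := K) (Φ := Φ) hp hp3 hp3' hdvd (i₀ := 0) (i₁ := 1)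
    h0 h1 hΦ
  have hζ1 : zetaOf (lev 1) (K 1) - (zetaOf (lev 1) (K 1))⁻¹ ∈ L 1 := by
    rw [hL1]; exact IntermediateField.subset_adjoin ℚ _ (Set.mem_singleton _)
  have hinj := injOn_restrict_weight_four_fourMulPrime (lev := lev) (K := K) (L := L) hp (i₀ := 0) (i₁ := 1) Fin.zero_ne_one
    h1 hL0 hζ1
  have hne : (pohlmannSetsAlg Ψ ((p + 1) / 4) \ pohlmannDivisorSetsAlg Ψ ((p + 1) / 4)).Nonempty :=
    diff_nonempty_subPair_of_injOn hind hW hinj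
  obtain ⟨c, hcQ, hcH, hcD⟩ := (exists_exceptional_biproduct_iff hB _).2 hne
  have hnotD : ¬IsDivisorGenerated (⨁ B) := fun hD => hcD (hD _ c hcQ hcH)
  have hnotS : ¬IsStablyNondegenerate (⨁ B) := not_isStablyNondegenerate_of_exists_exceptional hcQ hcH hcD
  obtain ⟨hPS, hPD, hPc⟩ := prod_of_biproduct_two' B
  have hdimP : 2 * ((B 0).prod (B 1)).dim = p + 1 := by rw [AbelianVariety.dim_prod]; omega
  exact ⟨L, Ψ, B, ιB, θB, hind, hB, hL0, hB0eq, hL1, hfin1, hiso1, hs, hd0, hd1, hB0st, hB1st, hu, hv, hne, ⟨c, hcQ, hcH, hcD⟩, hnotD,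
    hnotS, hdimP, hPc ⟨c, hcQ, hcH, hcD⟩, fun hD => hnotD (hPD hD), fun hS => hnotS (hPS hS)⟩

end FourFourMulPrime

/-! ## §4 Hypothesis-free: for every prime `p ≡ 3 (mod 4)`, `p ≥ 7`, a CM elliptic curve times a simple CM `(p−1)/2`-fold with `B ≠ D` on the product -/

section Existence

/-- **AN INFINITE FAMILY**: for every prime `p ≡ 3 (mod 4)`, `p ≥ 7`, there are a CM elliptic curve `E` (`= E_i`, complex multiplication by `ℚ(i)`)
and a SIMPLE abelian variety `Y` of ODD dimension `(p−1)/2` (`= Y_{4p}`, CM by `ℚ(ζ_{4p} − ζ_{4p}^{−1})`), both stably nondegenerate, with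
`Hom(E, Y) = 0 = Hom(Y, E)`, such that `E × Y` (dimension `(p+1)/2`) carries a rational `((p+1)/4, (p+1)/4)`-class outside `𝓓 ⊗ ℂ` — middle
codimension — and is neither divisor-generated nor stably nondegenerate.  (`p = 7`: a FOURFOLD `E_i × Y_{28}` with `B² ≠ D²`, Moonen–Zarhin's case (a);
`p = 11`: a sixfold with `B³ ≠ D³`; …) [cite: MoonenZarhin1999LowDim, Introduction (a) and Thm. 0.1 (1)] [cite: GalleseGoodsonLombardo2024, §3 Thm. 3.0 (5)]
[cite: Gordon1999HodgeAVSurvey, Thm. 7.6.2 and the remark following it] [cite: Shimura1998, §6.2 Thm. 3 and §8.2 Prop. 26] -/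
theorem exists_cmCurve_simple_odd_exceptional_prod {p : ℕ} (hp : p.Prime) (hp3 : p % 4 = 3) (hp7 : 7 ≤ p) :
    ∃ E Y : AbelianVariety ℂ, E.IsSimple ∧ Y.IsSimple ∧ E.dim = 1 ∧ 2 * Y.dim = p - 1 ∧
      IsStablyNondegenerate E ∧ IsStablyNondegenerate Y ∧ (∀ u : E ⟶ Y, u = 0) ∧ (∀ v : Y ⟶ E, v = 0) ∧
      2 * (E.prod Y).dim = p + 1 ∧
      (∃ c : complexBetti (E.prod Y).X (2 * ((p + 1) / 4)), IsRationalClass c ∧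
        IsOfHodgeType (E.prod Y).dim (E.prod Y).X (2 * ((p + 1) / 4)) ((p + 1) / 4) ((p + 1) / 4) c ∧
        c ∉ divisorClassesSpan (E.prod Y).X (E.prod Y).dim ((p + 1) / 4)) ∧
      ¬IsDivisorGenerated (E.prod Y) ∧ ¬IsStablyNondegenerate (E.prod Y) := by
  obtain ⟨K, _, _, _, _, Φ, A, ι, θ, hΦ, hA⟩ := exists_realisation_family (![4, 4 * p] : Fin 2 → ℕ)
    (Fin.forall_fin_two.2 ⟨by show (4 : ℕ) = 4 * (4 / 4); norm_num, by
      show (4 * p : ℕ) = 4 * (4 * p / 4)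
      rw [Nat.mul_div_cancel_left p (by norm_num)]⟩)
    (Fin.forall_fin_two.2 ⟨by show 0 < 4 / 4; norm_num, by
      show 0 < 4 * p / 4
      rw [Nat.mul_div_cancel_left p (by norm_num)]; exact hp.pos⟩)
  obtain ⟨L, Ψ, B, ιB, θB, -, -, -, -, -, -, -, hs, hd0, hd1, hB0, hB1, hu, hv, -, -, -, -, hdimP, hc, hD, hS⟩ :=
    exists_simpleFactors_exceptional_of_lev_eq_four_fourMulPrime (lev := (![4, 4 * p] : Fin 2 → ℕ)) (A := A) hp hp3 hp7 rfl rfl hΦ hA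
  exact ⟨B 0, B 1, hs 0, hs 1, hd0, hd1, hB0, hB1, hu, hv, hdimP, hc, hD, hS⟩

end Existence

/-! ## §5 `ℚ(i) ⊂ ℚ(ζ_{4p} − ζ_{4p}^{−1})`: the CM field of `Y_{4p}` contains the square root `ζ_{4p}^p` of `−1` (Moonen–Zarhin's `k ↪ End⁰(X₂)`) -/

section SqrtNegOne

variable {m : ℕ} [NeZero m] {K : Type} [Field K] [NumberField K] [IsCyclotomicExtension {m} ℚ K]

/-- **`ζ_{4p}^p ∈ ℚ(ζ_{4p} − ζ_{4p}^{−1})` and `(ζ_{4p}^p)² = −1`** (`p` odd, `4p ∉ {20, 24, 60}`, `4p ≥ 8`): the reflection `γ : ζ ↦ −ζ^{−1}` fixing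
`L = ℚ(ζ − ζ^{−1})` (the tree's `eq_fixedField_and_eq_adjoin_of_primitive_of_four_dvd`) sends `ζ^p` to `(−ζ^{−1})^p = −(ζ^p)^{−1} = ζ^p` because
`ζ^{2p} = −1`.  Hence the imaginary quadratic field `k = ℚ(i)` of the CM elliptic curve `E_i = X_4` EMBEDS into the CM field `L` of the simple
factor `Y_{4p}` — Moonen–Zarhin's hypothesis «there exists an embedding `k ↪ End⁰(X₂)`» of case (a) for `E_i × Y_{4p}` (as far as `L ↪ End⁰(Y_{4p})`,
which the realisation `ιB : 𝓞_L → End(Y_{4p})` provides on `𝓞_L`). [cite: MoonenZarhin1999LowDim, Introduction (a) and Thm. 0.1 (1)]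
[cite: GalleseGoodsonLombardo2024, §3 Thm. 3.0 (5) and §3.2 Lemma 11] [cite: Washington1997, Ch. 2 (basic cyclotomic relations)] -/
theorem zetaOf_pow_mem_and_sq_eq_neg_one_of_eq_adjoin {p : ℕ} (hp : Odd p) (hm : m = 4 * p) (h8 : 8 ≤ m) (h20 : m ≠ 20) (h24 : m ≠ 24)
    (h60 : m ≠ 60) {Φ : CMType K} (hΦ : ∀ σ : K →+* ℂ, σ ∈ Φ.1 ↔ 2 * (expOf m K σ).val < m)
    {L : IntermediateField ℚ K} (hL : L = IntermediateField.adjoin ℚ {zetaOf m K - (zetaOf m K)⁻¹}) :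
    zetaOf m K ^ p ∈ L ∧ (zetaOf m K ^ p) ^ 2 = -1 := by
  have h4 : 4 ∣ m := ⟨p, hm⟩
  obtain ⟨K₁, Φ₁, h₁, hp₁, -⟩ := exists_primitive_inducedCMType_index_two_of_four_dvd h4 h8 h20 h24 h60 Φ hΦ
  obtain ⟨γ, hγ, -, hfix, -, -, -, -, hK₁⟩ := eq_fixedField_and_eq_adjoin_of_primitive_of_four_dvd h4 h8 h20 h24 h60 Φ hΦ Φ₁ h₁ hp₁
  have hLK : L = K₁ := hL.trans hK₁.symm
  subst hLK
  have hprim : IsPrimitiveRoot (zetaOf m K) m := IsCyclotomicExtension.zeta_spec m ℚ K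
  have hsq : (zetaOf m K ^ p) ^ 2 = -1 := by
    rw [← pow_mul]
    exact (hprim.pow (by omega) (show m = p * 2 * 2 by omega)).eq_neg_one_of_two_right
  have hinv : (zetaOf m K ^ p)⁻¹ = -(zetaOf m K ^ p) := by
    refine inv_eq_of_mul_eq_one_right ?_
    rw [mul_neg, ← sq, hsq, neg_neg]
  refine ⟨(hfix _).2 ?_, hsq⟩
  rw [map_pow, hγ, neg_pow, hp.neg_one_pow, inv_pow, hinv]
  ring

end SqrtNegOne

end HyperellipticJacobian

end Literature.AlgebraicGeometry.ComplexMultiplication
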